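import Summits.QuantumFields.YangMills.Theses.OneCertifiedCube
import Summits.QuantumFields.YangMills.Theses.ContractibleFibre
import Summits.QuantumFields.YangMills.Theses.GronwallGap
import Summits.QuantumFields.YangMills.Theorems.EquipartitionCriticalityEquipartitionPinsProbe
import Summits.QuantumFields.YangMills.Theorems.EquipartitionCriticalityFreeEnergyLogCoefficient
import Summits.QuantumFields.YangMills.Theorems.EquipartitionCriticalityRPProbeCriticality

/-!
# Route `OneCertifiedCube`, crux `ContinuumLimitExists` (stmt-QuantumFields-16124): the supplier web of the crux

Line lead `prover-line-stmt-QuantumFields-16124-c1-0` (continuation seat c1, 2026-08-17), line `registered`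
(= `Cruxes/ContinuumLimitExists/Lines/birth.lean` v3). This file records, as kernel-checked implications, where the
crux E = `OneCertifiedCube.ContinuumLimitExists` (for every compact simple `G`: a faithful lattice representation, a
weak-coupling Wilson scheme and OS data with `IsYangMillsFor`, non-trivial and non-Gaussian curvature) sits in the
sub-problem:

* E is NECESSARY: it is the projection of the summit statement `YangMills` onto its four existence clauses
  (`continuumLimitExists_of_yangMills`), so every route of `YangMills` proves E in substance;
* E is SUPPLIED, by the same projection, by each conditional existence leg of the other constructive routes together
  with that leg's own lattice hypotheses — all EXISTING ledger items, none closed: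
  - route `ContractibleFibre`: `UniformLatticeGap` (stmt-QuantumFields-8778) + `WeakCouplingContinuumLeg`
    (stmt-QuantumFields-15828) ⟹ E (`continuumLimitExists_of_weakCouplingContinuumLeg`);
  - route `GronwallGap`: `LatticeGapOffTransitions` (stmt-QuantumFields-8799) + `ContinuumFromLatticeGap`
    (stmt-QuantumFields-15915) ⟹ E (`continuumLimitExists_of_continuumFromLatticeGap`);
  - route `EquipartitionCriticality`: `LatticeGapLargeBeta` (stmt-QuantumFields-8761) + `CriticalContinuumLimit`
    (stmt-QuantumFields-15940) ⟹ E, the criticality hypothesis of the leg being DISCHARGED by the route's three proved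
    items `freeEnergyLogCoefficient_proof`, `EquipartitionPinsProbe_proof`, `rpProbeCriticality_proof`
    (`continuumLimitExists_of_criticalContinuumLimit`).

Nothing here closes E (each implication is conditional on open items); the theorems are `--supports` glue so that the
gate and the planners can treat E as a consequence node of those item pairs (the line's own residue — `stub_uvScheme`,
`stub_rotation345`, `stub_coreClustering` — is the unconditional road). No statement is introduced.
-/

set_option autoImplicit false

namespace Summit.QuantumFields.YangMills.Cruxes.ContinuumLimitExists.Birth

open Literature.MathematicalPhysics.QuantumFieldTheory

/-- **E is necessary**: the summit statement `YangMills` implies `ContinuumLimitExists` (drop the mass-gap clause of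
the witness). -/
theorem continuumLimitExists_of_yangMills :
    YangMills → Summit.QuantumFields.YangMills.Theses.OneCertifiedCube.ContinuumLimitExists := by
  intro h G _ _ _ _ hG
  letI : MeasurableSpace G := borel G
  haveI : BorelSpace G := ⟨rfl⟩
  obtain ⟨r, sch, T, hW, hYM, hNT, hNG, -⟩ := h G hG
  exact ⟨r, sch, T, hW, hYM, hNT, hNG⟩

/-- **Supplier: route `ContractibleFibre`.** The volume-uniform weak-coupling lattice mass gap for every faithful
representation (`UniformLatticeGap`, stmt-QuantumFields-8778) and that route's conditional continuum leg
(`WeakCouplingContinuumLeg`, stmt-QuantumFields-15828) give `ContinuumLimitExists`. -/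
theorem continuumLimitExists_of_weakCouplingContinuumLeg :
    Summit.QuantumFields.YangMills.Theses.ContractibleFibre.UniformLatticeGap →
      Summit.QuantumFields.YangMills.Theses.ContractibleFibre.WeakCouplingContinuumLeg →
        Summit.QuantumFields.YangMills.Theses.OneCertifiedCube.ContinuumLimitExists := by
  intro hGap hLeg G _ _ _ _ hG
  letI : MeasurableSpace G := borel G
  haveI : BorelSpace G := ⟨rfl⟩
  obtain ⟨r, sch, T, hW, hYM, hNT, hNG, -⟩ := hLeg G hG fun r => hGap G hG r
  exact ⟨r, sch, T, hW, hYM, hNT, hNG⟩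

/-- **Supplier: route `GronwallGap`.** The all-couplings lattice gap off a locally finite exceptional set
(`LatticeGapOffTransitions`, stmt-QuantumFields-8799) and that route's conditional continuum leg
(`ContinuumFromLatticeGap`, stmt-QuantumFields-15915) give `ContinuumLimitExists`. -/
theorem continuumLimitExists_of_continuumFromLatticeGap :
    Summit.QuantumFields.YangMills.Theses.GronwallGap.LatticeGapOffTransitions →
      Summit.QuantumFields.YangMills.Theses.GronwallGap.ContinuumFromLatticeGap →
        Summit.QuantumFields.YangMills.Theses.OneCertifiedCube.ContinuumLimitExists := by
  intro hGap hLeg G _ _ _ _ hG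
  letI : MeasurableSpace G := borel G
  haveI : BorelSpace G := ⟨rfl⟩
  obtain ⟨r, sch, T, hW, hYM, hNT, hNG, -⟩ := hLeg G hG fun r => hGap G hG r
  exact ⟨r, sch, T, hW, hYM, hNT, hNG⟩

/-- **Supplier: route `EquipartitionCriticality`.** The weak-coupling lattice gap in Chatterjee's volume-uniform
form (`LatticeGapLargeBeta`, stmt-QuantumFields-8761) and that route's conditional continuum leg at the critical point
`β = ∞` (`CriticalContinuumLimit`, stmt-QuantumFields-15940) give `ContinuumLimitExists`; the leg's criticality
hypothesis is discharged by the route's PROVED items (`freeEnergyLogCoefficient_proof` ∘ `EquipartitionPinsProbe_proof`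
∘ `rpProbeCriticality_proof`, exactly as in `EquipartitionCriticality.closes`). -/
theorem continuumLimitExists_of_criticalContinuumLimit :
    Summit.QuantumFields.YangMills.Theses.EquipartitionCriticality.LatticeGapLargeBeta →
      Summit.QuantumFields.YangMills.Theses.EquipartitionCriticality.CriticalContinuumLimit →
        Summit.QuantumFields.YangMills.Theses.OneCertifiedCube.ContinuumLimitExists := by
  intro hGap hLeg G _ _ _ _ hG
  letI : MeasurableSpace G := borel G
  haveI : BorelSpace G := ⟨rfl⟩
  obtain ⟨r, sch, T, hW, hYM, hNT, hNG, -⟩ := hLeg G hG (fun r => hGap G hG r) fun r =>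
    Summit.QuantumFields.YangMills.Theorems.rpProbeCriticality_proof G hG r
      (Summit.QuantumFields.YangMills.Theorems.EquipartitionPinsProbe_proof G hG r
        (Summit.QuantumFields.YangMills.Theorems.freeEnergyLogCoefficient_proof G hG r))
  exact ⟨r, sch, T, hW, hYM, hNT, hNG⟩

end Summit.QuantumFields.YangMills.Cruxes.ContinuumLimitExists.Birth
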